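import Summits.QuantumFields.YangMills.Theorems.BalabanUVNodesN21ThresholdMixtureRStepLocalityNormalise
import Summits.QuantumFields.YangMills.Theorems.BalabanUVNodesN20ChiSemantics

/-!
# N21 (NE7c), strategy s3 «alternative currency», file 26 — ROW L′'s RAW ROAD READ TO THE END: at RAW `bgOfRecord` letters with the record's GLOBAL
# regularity class the (2.16) problem on `□^{≈4}` is solvable ONLY IF the datum `Q_k^{s*}V` is regular on every FAR `Γ₀`-plaquette; ONE far large
# level-`k` plaquette makes `U_{k,□}(V)` the unit configuration (junk branch) and the χ-slot of `□` READ SMALL — so file 22b's plaquette-level (LOC)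
# hypothesis `hlocP` is REFUTABLE at raw letters (uniqueness-mod-gauge does not rescue the raw road; `normalise` ∕ a support-local class does)

HEADER — WORK-UNIT METADATA.  Seat `pub-ymgap-dag-n21-e` (R141 (C) fan-out, node N21 = NE7c `T4IndicatorShell.ShellWeightBound`, strategy s3), g9, file 26.
Lane: `--kind proof --supports stmt-QuantumFields-20296 --as helper` (K3⁵ `SpineGivenEndpointR13SepCoP`, plan g68 KEY-20 ∕ dag-lead WORDS-141).  Count-neutral.
Trigger t21 of this seat's g8 HANDOFF («def-R ∕ def-χ ROW L′ answer raw-vs-normalise ⇒ raw: type the `huniq`-keyed OFF road at 13b's letters») answered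
BY THE TREE: def-R FILE 22′ (p519921) D5∕D6 keep the RAW selector `bgOfRecord`; the lens `ym-lens-BalabanUVNodes-nearmiss` v12.0∕g13 (bus l.18639 ∕ l.18911)
reads ROW L′ as «raw ⇒ `huniq` road, `normalise` ⇒ DISCHARGED by 22c».  This file walks the raw road to its end and finds it CLOSED before uniqueness is
ever reached — a located typing point for def-R ∕ def-χ, made kernel.

THE CONTENT.  Objects BY NAME: r12's (2.12) predicate `B15DeterminingSets.IsMinimizer av reg 𝔹 X U₀` (`U₀ ∈ reg ∧ M_𝔹(U₀) = X ∧ minimal`), def-R's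
TOTALISED solution map `Node00.UminOfRecord av reg 𝔹 X` (a minimiser when one exists, THE UNIT CONFIGURATION otherwise — `UminOfRecord_of_not`) and
`Node00.bgOfRecord av reg` (domain = the solvable set), r11's (2.16) `B14.Eq216Concrete.ukBox bg M₁ □^{≈4} k V = bg.U (𝐁_k(□^{≈4})) (M˙(Q_k^{s*}V))` and
(1.3)-with-k-blocks `qsstarGIter0_of_not_interior`, r11's `B14.Eq12InteriorLocality.plaqBonds` ∕ `plaqHol_congr`, `B14.Eq213DetSet.extBonds` (the bonds of
the scale-0 member `Γ₀ = Ω₁(□^{≈4})ᶜ`, (2.2)), n20-d's `N20ChiSemantics.plaqHol_const_one` (cited).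
§1 (generic: any torus, group, averaging, class).  (1a) A minimiser IS the datum on every `Γ₀`-bond (the (2.12) constraint at scale 0, `M⁰ = id`;
lens (L1) `ukBox_apply_of_mem_extBonds` at the predicate level: `apply_eq_datum_of_isMinimizer`), hence its plaquette variable on a FAR plaquette — all
four bonds in `extBonds 𝔹` — is the datum's (`plaqHol_eq_datum_of_isMinimizer`).  (1b) So if the class `reg` constrains that plaquette (`∀ U ∈ reg,
U(∂p) ∈ good`) and the datum violates it, the (2.12) problem for `(𝔹, X)` HAS NO SOLUTION (`not_solvable_of_farPlaq`) and the totalised map returns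
the unit configuration (`UminOfRecord_eq_one_of_farPlaq`).  (1c) At (2.16) letters with a GLOBAL small-plaquette class `{U | PlaqSmall δ U}`:
`δ ≤ |Q_k^{s*}V(∂p) − 1|` on ONE far plaquette `p` ⇒ `U_{k,□}(V) = 1` (`ukBox_bgOfRecord_eq_one_of_farLarge`), every plaquette variable of it is `1`,
its block-sup statistic over ANY tested family is `0` (`dist1_plaqHol_ukBox_eq_zero_of_farLarge`, `iSup_dist1_ukBox_eq_zero_of_farLarge`) and the
χ-slot `chiSmall T θ (U_{k,□}(V)) = 1` for every `θ > 0` (`chiSmall_ukBox_eq_one_of_farLarge`): A FAR LARGE FIELD FORCES THE RAW SLOT TO READ SMALL.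
(1d) NEGATIVE EDGE (`not_localPlaq_bgOfRecord_of_witness`): consequently the plaquette-level locality hypothesis of file 22b (`hlocP`: the tested
plaquette variables of `U_{k,□}(·)` are invariant under updates on a fibre `s`) FAILS at raw letters as soon as (i) one configuration `V₁` has a tested
plaquette variable `≠ 1` (a solvable datum with non-trivial interior — in print: every small-field configuration) and (ii) some update of `V₁` on `s`
makes a far `Γ₀`-plaquette of the datum `δ`-large — whatever uniqueness-mod-gauge ([15] Thm 1) would say about the solvable case.
§2 (`plaqHol_qsstarGIter0_corner`).  WHICH far plaquettes can be large: by (1.3) with k-blocks a scale-0 plaquette whose four vertices lie in the four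
k-blocks `B, B+e_μ, B+e_ν, B+e_μ+e_ν` reads the COARSE plaquette, `Q_k^{s*}V(∂p) = V(∂P)`, `P = ⟨B, μ, ν⟩` (plaquettes inside a block or across one
face read `1`).  So (1c)'s hypothesis is «one level-`k` plaquette `P` of `T^{(k)}`, cornered far from `□^{≈4}`, with `δ ≤ |V(∂P) − 1|`»
(`ukBox_bgOfRecord_eq_one_of_farLargeCoarse`).
§3 AT THE RECORD (13b ∕ 22b letters: `bgOfRecord (avOfRecord F N K) {U | PlaqSmall (εreg·η_k²) U}`, `□ = cubeEnl … a ·`, tested family `plaqInside (□^∼)`):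
★ `ukBox_record_eq_one_of_farLarge` · `recordStat_eq_zero_of_farLarge` · ★ `chiSlot_record_eq_one_of_farLarge` · ★★ `not_hlocP_record_of_witness` — the
`hlocP` binder of 22b's `fibreIndep_recordStat_of_localPlaq`, VERBATIM, is refutable under (i)–(ii).

LOCATED POINT (def-R ∕ def-χ, ROW L′; count-neutral, NOT a finding against any K text — no K text names χ's value).  As typed, the record's (2.17)
factor `χ_k(□)(V)` at RAW letters is JUNK-`1` on every configuration with one far `εreg·η_k²`-large level-`k` plaquette — i.e. on the large-field part
of the step-`k` measure, where (2.18) DOES evaluate it (the density `T_k(Z_k, 𝔄_k)` carries `V_k` unrestricted on `Z_k`).  The cause is not the selector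
but the CLASS: `{U | PlaqSmall (εreg·η_k²) U}` constrains the WHOLE fine torus, and every minimiser carries the datum on all of `Γ₀ = Ω₁(□^{≈4})ᶜ`
(r11 `B14Eq216Concrete` READING NOTE; print p. 255 *"The domain Ω₁, or rather a small neighborhood of Ω₁ …, is called its support"*, p. 246 *"depends on
the field V restricted to □′^{∼4}"* — print's regularity lives on the support's neighbourhood).  Cures, either of which keeps 22b∕22c's road: (i) read χ
through `normalise (bgOfRecord …) (plaqDetermined_plaqSmall _)` (22c `fibreIndep_supStat_ukBox_normalise`: plaquette-local for ALL data; its interior is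
the minimiser for `rep X`, which forgets far data), or (ii) a SUPPORT-LOCAL class `{U | PlaqSmallOn (plaquettes over □^{≈4}) (εreg·η_k²) U}` (r11
`plaqDetermined_plaqSmallOn`), under which (1b)'s hypothesis is void for far plaquettes.

HONEST FRAMING.  NE7c is NOT PRINTED and NOT PROVED.  [folklore] bookkeeping over r11 ∕ r12 ∕ def-R letters; solvability, existence and uniqueness of
minimisers ([Balaban1985PropagatorsII] ∕ [15] Thm 1) are NOWHERE asserted — (1d)'s witness is a HYPOTHESIS; nothing of Bałaban's is contradicted (in
print the far cube carries its own `χ = 0` there and the configuration belongs to the 𝐑-operation's region); N21 NOT discharged; counts UNMOVED;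
count-neutral; one finite 𝕋⁴ at fixed `ε`; NOT ℝ⁴ ∕ OS ∕ mass gap ∕ Clay.

CITATION HEADER (lean-in-tree rule 2026-08-18).  BY NAME: r12 `B15DeterminingSets.IsMinimizer` ∕ `AgreeOn` ∕ `avgFamily`; def-R `Node00.UminOfRecord` ∕
`UminOfRecord_of_not` ∕ `bgOfRecord` ∕ `avOfRecord` ∕ `Stage7Numerics` ∕ `RkOfRecord`; r11 `B14.Eq216Concrete.ukBox` ∕ `qsstarGIter0_of_not_interior` ∕
`blockIter`, `B14.Eq213DetSet.Bj` ∕ `extBonds`, `B14.Eq12InteriorLocality.plaqBonds` ∕ `plaqHol_congr`, `Setup.PlaqSmall` ∕ `chiSmall` ∕ `GaugeField.plaqHol`;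
n21-c's `BlockAveragingEMLProp2.shift_shift_comm`; n20-d `N20ChiSemantics.plaqHol_const_one` (its §3 `ukBox_eq_one_of_not_solvable` ∕ `chiSmall_ukBox_eq_one_of_not_solvable` are the record-letter
parents of (1b)–(1c): «χ = 1 BY JUNK off the solvable set»; NEW here: WHEN the set is left — one far large plaquette —, the corner identity, the negative
edge); 22b `fibreIndep_recordStat_of_localPlaq` (its `hlocP` binder negated verbatim).  Context only (SHAPE, nothing asserted): [Balaban1988Convergent]
(1.3) p. 246, (2.2) p. 255, (2.12) p. 256, (2.16)–(2.18) p. 257.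

WHAT IS PROVED ([folklore]).  §1 `apply_eq_datum_of_isMinimizer` · `plaqHol_eq_datum_of_isMinimizer` · `not_solvable_of_farPlaq` · `UminOfRecord_eq_one_of_farPlaq` ·
★ `ukBox_bgOfRecord_eq_one_of_farLarge` · `dist1_plaqHol_ukBox_eq_zero_of_farLarge` · `iSup_dist1_ukBox_eq_zero_of_farLarge` · ★ `chiSmall_ukBox_eq_one_of_farLarge` ·
★★ `not_localPlaq_bgOfRecord_of_witness`; §2 `site_shift_ne_self` · ★ `plaqHol_qsstarGIter0_corner` · `ukBox_bgOfRecord_eq_one_of_farLargeCoarse`;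
§3 ★ `ukBox_record_eq_one_of_farLarge` · `recordStat_eq_zero_of_farLarge` · ★ `chiSlot_record_eq_one_of_farLarge` · ★★ `not_hlocP_record_of_witness`.
-/

set_option autoImplicit false

noncomputable section

open Set
open scoped BigOperators

namespace Summit.QuantumFields.YangMills.Theorems.N21ThresholdMixtureRStepLocalityRaw

open Literature.MathematicalPhysics.QuantumFieldTheory.Balaban1983to89
open B15DeterminingSets B14.Eq213DetSet B14.Eq216Concrete B14.Eq12InteriorLocality
open Literature.MathematicalPhysics.QuantumFieldTheory.BalabanImbrieJaffe1984to88.BIJ85Eq453GaugeField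
open Literature.MathematicalPhysics.QuantumFieldTheory.Balaban1983to89.Node00 (UminOfRecord UminOfRecord_of_not bgOfRecord)
open Summit.QuantumFields.YangMills.BalabanUVNodes.N20ChiSemantics (plaqHol_const_one)

/-! ## §1 Generic: a far large plaquette of the datum empties the solvable set; the totalised raw map then reads `1` -/

section Generic

variable {P : Params} {G : Type*} [GaugeGroup G] {av : ∀ j, Averaging P j G} {reg : Set (GaugeField P 0 G)}

/-- (1a) A minimal configuration of (2.12) IS the datum on every `Γ₀`-bond of the determining set (the constraint at scale `0`, `M⁰ = id`).
[cite: Balaban1988Convergent, (2.2) p.255, (2.12) p.256] -/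
theorem apply_eq_datum_of_isMinimizer {𝔹 : DetSet P} {X : MSField P G} {U₀ : GaugeField P 0 G} (h : IsMinimizer av reg 𝔹 X U₀)
    {b : PBond P 0} (hb : b ∈ extBonds 𝔹) : U₀ b = X 0 b :=
  h.2.1 0 b hb

/-- (1a′) … hence on a FAR plaquette (all four bonds `Γ₀`-bonds) its plaquette variable is the datum's. [cite: Balaban1988Convergent, (2.12) p.256] -/
theorem plaqHol_eq_datum_of_isMinimizer {𝔹 : DetSet P} {X : MSField P G} {U₀ : GaugeField P 0 G} (h : IsMinimizer av reg 𝔹 X U₀)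
    {p : Plaq P 0} (hp : plaqBonds p ⊆ extBonds 𝔹) : GaugeField.plaqHol U₀ p = GaugeField.plaqHol (X 0) p :=
  plaqHol_congr fun _ hb => apply_eq_datum_of_isMinimizer h (hp hb)

/-- (1b) **A FAR PLAQUETTE OF THE DATUM OUTSIDE THE CLASS EMPTIES THE SOLVABLE SET**: if membership in `reg` constrains the plaquette variable at a far
plaquette `p` and the datum violates the constraint there, the (2.12) problem for `(𝔹, X)` has no solution. [cite: Balaban1988Convergent, (2.12) p.256] -/
theorem not_solvable_of_farPlaq {𝔹 : DetSet P} {X : MSField P G} {p : Plaq P 0} (hp : plaqBonds p ⊆ extBonds 𝔹) {good : Set G}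
    (hreg : ∀ U ∈ reg, GaugeField.plaqHol U p ∈ good) (hX : GaugeField.plaqHol (X 0) p ∉ good) :
    ¬ ∃ U₀, IsMinimizer av reg 𝔹 X U₀ := by
  rintro ⟨U₀, h⟩
  exact hX (plaqHol_eq_datum_of_isMinimizer h hp ▸ hreg U₀ h.1)

variable [MeasurableSpace G]

/-- (1b′) … so def-R's TOTALISED solution map returns the unit configuration (junk branch `UminOfRecord_of_not`).
[cite: Balaban1988Convergent, (2.12) p.256 (typing convention)] -/
theorem UminOfRecord_eq_one_of_farPlaq {𝔹 : DetSet P} {X : MSField P G} {p : Plaq P 0} (hp : plaqBonds p ⊆ extBonds 𝔹) {good : Set G}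
    (hreg : ∀ U ∈ reg, GaugeField.plaqHol U p ∈ good) (hX : GaugeField.plaqHol (X 0) p ∉ good) :
    UminOfRecord av reg 𝔹 X = fun _ => 1 :=
  UminOfRecord_of_not av reg (not_solvable_of_farPlaq hp hreg hX)

variable (av) (M₁ : ℕ)

/-- ★ (1c) **AT (2.16) LETTERS WITH A GLOBAL SMALL-PLAQUETTE CLASS, ONE FAR LARGE PLAQUETTE OF THE DATUM `Q_k^{s*}V` MAKES `U_{k,□}(V)` THE UNIT
CONFIGURATION.** [cite: Balaban1988Convergent, (2.16) p.257 (typing convention)] -/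
theorem ukBox_bgOfRecord_eq_one_of_farLarge {δ : ℝ} {box4 : Set (Site P 0)} {k : ℕ} {V : GaugeField P k G} {p : Plaq P 0}
    (hp : plaqBonds p ⊆ extBonds (Bj M₁ box4 k)) (hfar : δ ≤ dist1 (GaugeField.plaqHol (qsstarGIter0 k V) p)) :
    ukBox (bgOfRecord av {U | PlaqSmall δ U}) M₁ box4 k V = fun _ => 1 :=
  UminOfRecord_eq_one_of_farPlaq (reg := {U | PlaqSmall δ U}) hp (good := {g | dist1 g < δ}) (fun _ hU => hU p) (not_lt.2 hfar)

/-- (1c′) … so every plaquette variable of `U_{k,□}(V)` is at distance `0` from `1`. [cite: Balaban1988Convergent, (2.16)–(2.17) p.257 (typing convention)] -/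
theorem dist1_plaqHol_ukBox_eq_zero_of_farLarge {δ : ℝ} {box4 : Set (Site P 0)} {k : ℕ} {V : GaugeField P k G} {p : Plaq P 0}
    (hp : plaqBonds p ⊆ extBonds (Bj M₁ box4 k)) (hfar : δ ≤ dist1 (GaugeField.plaqHol (qsstarGIter0 k V) p)) (q : Plaq P 0) :
    dist1 (GaugeField.plaqHol (ukBox (bgOfRecord av {U | PlaqSmall δ U}) M₁ box4 k V) q) = 0 := by
  rw [ukBox_bgOfRecord_eq_one_of_farLarge av M₁ hp hfar, plaqHol_const_one, GaugeGroup.dist1_one]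

/-- (1c″) … so the block-sup statistic of `U_{k,□}(V)` over ANY tested plaquette family is `0`. [cite: Balaban1988Convergent, (2.17) p.257 (typing convention)] -/
theorem iSup_dist1_ukBox_eq_zero_of_farLarge {δ : ℝ} {box4 : Set (Site P 0)} {k : ℕ} {V : GaugeField P k G} {p : Plaq P 0}
    (hp : plaqBonds p ⊆ extBonds (Bj M₁ box4 k)) (hfar : δ ≤ dist1 (GaugeField.plaqHol (qsstarGIter0 k V) p)) (T : Set (Plaq P 0)) :
    (⨆ q : T, dist1 (GaugeField.plaqHol (ukBox (bgOfRecord av {U | PlaqSmall δ U}) M₁ box4 k V) q.1)) = 0 := by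
  simp only [dist1_plaqHol_ukBox_eq_zero_of_farLarge av M₁ hp hfar]
  exact Real.iSup_const_zero

/-- ★ (1c‴) **A FAR LARGE FIELD FORCES THE RAW χ-SLOT TO READ SMALL**: `χ(T, θ)(U_{k,□}(V)) = 1` for every tested family `T` and threshold `θ > 0`.
[cite: Balaban1988Convergent, (2.17) p.257 (typing convention)] -/
theorem chiSmall_ukBox_eq_one_of_farLarge {δ : ℝ} {box4 : Set (Site P 0)} {k : ℕ} {V : GaugeField P k G} {p : Plaq P 0}
    (hp : plaqBonds p ⊆ extBonds (Bj M₁ box4 k)) (hfar : δ ≤ dist1 (GaugeField.plaqHol (qsstarGIter0 k V) p)) (T : Set (Plaq P 0))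
    {θ : ℝ} (hθ : 0 < θ) : chiSmall T θ (ukBox (bgOfRecord av {U | PlaqSmall δ U}) M₁ box4 k V) = 1 := by
  unfold chiSmall
  rw [if_pos]
  intro q _
  rw [dist1_plaqHol_ukBox_eq_zero_of_farLarge av M₁ hp hfar]
  exact hθ

/-- ★★ (1d) **NEGATIVE EDGE FOR THE RAW ROAD**: file 22b's plaquette-level locality hypothesis (the tested plaquette variables of `U_{k,□}(·)` are
invariant under updates on the fibre `s`) is REFUTABLE at raw letters, given (i) one configuration `V₁` with a tested plaquette variable `≠ 1` and (ii) an
`s`-update of `V₁` making a far `Γ₀`-plaquette of the datum `δ`-large. [cite: Balaban1988Convergent, (2.16)–(2.17) p.257 (typing convention)] -/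
theorem not_localPlaq_bgOfRecord_of_witness {δ : ℝ} {box4 : Set (Site P 0)} {k : ℕ} [DecidableEq (PBond P k)] (s : Finset (PBond P k))
    (T : Set (Plaq P 0)) {p : Plaq P 0} (hp : plaqBonds p ⊆ extBonds (Bj M₁ box4 k))
    {V₁ : GaugeField P k G} {q : Plaq P 0} (hq : q ∈ T) (hV₁ : GaugeField.plaqHol (ukBox (bgOfRecord av {U | PlaqSmall δ U}) M₁ box4 k V₁) q ≠ 1)
    {y : s → G} (hy : δ ≤ dist1 (GaugeField.plaqHol (qsstarGIter0 k (Function.updateFinset V₁ s y)) p)) :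
    ¬ ∀ (V : GaugeField P k G) (y : s → G) (q : T),
        GaugeField.plaqHol (ukBox (bgOfRecord av {U | PlaqSmall δ U}) M₁ box4 k (Function.updateFinset V s y)) q.1
          = GaugeField.plaqHol (ukBox (bgOfRecord av {U | PlaqSmall δ U}) M₁ box4 k V) q.1 := by
  intro h
  have h1 := h V₁ y ⟨q, hq⟩
  rw [ukBox_bgOfRecord_eq_one_of_farLarge av M₁ hp hy, plaqHol_const_one] at h1
  exact hV₁ h1.symm

end Generic

/-! ## §2 Which far plaquettes can be large: a scale-0 plaquette at a k-block CORNER reads the coarse plaquette `V(∂P)` -/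

section Corner

open B14.Eq22Determines (blockIter)
open BlockAveragingEMLProp2 (shift_shift_comm)

variable {P : Params} {G : Type*} [GaugeGroup G]

/-- `y + e_μ ≠ y` on every torus of the series (`1 ≠ 0` in `ZMod (2L^{m+K−j})`; adapted from r11 `B14Eq216Concrete`'s private twin). [folklore] -/
theorem site_shift_ne_self {j : ℕ} (y : Site P j) (μ : Fin P.d) : y.shift μ ≠ y := by
  intro h
  have h1 := congrFun h μ
  simp only [Site.shift, Function.update_self] at h1
  exact one_ne_zero (add_eq_left.1 h1)

/-- ★ **(1.3) WITH k-BLOCKS AT A BLOCK CORNER**: a scale-0 plaquette `p = ⟨x, μ, ν⟩` whose vertices `x, x+e_μ, x+e_ν, x+e_μ+e_ν` lie in the k-blocks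
`B, B+e_μ, B+e_ν, B+e_μ+e_ν` has `Q_k^{s*}V`-variable the COARSE plaquette variable `V(∂P)`, `P = ⟨B, μ, ν⟩` (its four bonds are corridor bonds reading
the four bonds of `∂P`, `qsstarGIter0_of_not_interior`). [cite: Balaban1988Convergent, (1.3) p.246, (2.16) p.257] -/
theorem plaqHol_qsstarGIter0_corner {k : ℕ} (hk : k ≤ P.m + P.K) (V : GaugeField P k G) (p : Plaq P 0) (B : Site P k)
    (h0 : blockIter k p.src = B) (hμ : blockIter k (p.src.shift p.μ) = B.shift p.μ) (hν : blockIter k (p.src.shift p.ν) = B.shift p.ν)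
    (hμν : blockIter k ((p.src.shift p.μ).shift p.ν) = (B.shift p.μ).shift p.ν) :
    GaugeField.plaqHol (qsstarGIter0 k V) p = GaugeField.plaqHol V ⟨B, p.μ, p.ν, p.hμν⟩ := by
  unfold GaugeField.plaqHol
  rw [qsstarGIter0_of_not_interior hk V (b := ⟨p.src, p.μ⟩)
      (show blockIter k (p.src.shift p.μ) ≠ blockIter k p.src by rw [hμ, h0]; exact site_shift_ne_self B p.μ),
    qsstarGIter0_of_not_interior hk V (b := ⟨p.src.shift p.μ, p.ν⟩)
      (show blockIter k ((p.src.shift p.μ).shift p.ν) ≠ blockIter k (p.src.shift p.μ) by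
        rw [hμν, hμ]; exact site_shift_ne_self _ p.ν),
    qsstarGIter0_of_not_interior hk V (b := ⟨p.src.shift p.ν, p.μ⟩)
      (show blockIter k ((p.src.shift p.ν).shift p.μ) ≠ blockIter k (p.src.shift p.ν) by
        rw [← shift_shift_comm, hμν, hν, shift_shift_comm]; exact site_shift_ne_self _ p.μ),
    qsstarGIter0_of_not_interior hk V (b := ⟨p.src, p.ν⟩)
      (show blockIter k (p.src.shift p.ν) ≠ blockIter k p.src by rw [hν, h0]; exact site_shift_ne_self B p.ν)]
  simp only [h0, hμ, hν]

variable [MeasurableSpace G] (av : ∀ j, Averaging P j G) (M₁ : ℕ)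

/-- (2′) **ONE FAR LARGE LEVEL-`k` PLAQUETTE, CORNERED IN `Γ₀`, MAKES `U_{k,□}(V) = 1`** ((1c) with §2's identity).
[cite: Balaban1988Convergent, (1.3) p.246, (2.16) p.257 (typing convention)] -/
theorem ukBox_bgOfRecord_eq_one_of_farLargeCoarse {δ : ℝ} {box4 : Set (Site P 0)} {k : ℕ} (hk : k ≤ P.m + P.K) {V : GaugeField P k G}
    {p : Plaq P 0} (hp : plaqBonds p ⊆ extBonds (Bj M₁ box4 k)) {B : Site P k}
    (h0 : blockIter k p.src = B) (hμ : blockIter k (p.src.shift p.μ) = B.shift p.μ) (hν : blockIter k (p.src.shift p.ν) = B.shift p.ν)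
    (hμν : blockIter k ((p.src.shift p.μ).shift p.ν) = (B.shift p.μ).shift p.ν)
    (hlarge : δ ≤ dist1 (GaugeField.plaqHol V ⟨B, p.μ, p.ν, p.hμν⟩)) :
    ukBox (bgOfRecord av {U | PlaqSmall δ U}) M₁ box4 k V = fun _ => 1 :=
  ukBox_bgOfRecord_eq_one_of_farLarge av M₁ hp (by rwa [plaqHol_qsstarGIter0_corner hk V p B h0 hμ hν hμν])

end Corner

/-! ## §3 At the record's χ-slots (13b ∕ 22b letters) -/

section AtRecord

open Literature.MathematicalPhysics.QuantumFieldTheory.Balaban1983to89.Node00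
open T4Continuum B15DeterminingSets B14.Eq213DetSet B14.Eq216Concrete B14.Eq213MaximalDomains B15Eq112TorusCover B14DomainGeom
  B14.Eq218Concrete

variable (F : T4Family) (N : ℕ) [NeZero N]

/-- ★ **AT THE RECORD: one scale-0 plaquette `p` far from `□_a^{≈4}` (bonds in `extBonds (𝐁_k(□_a^{≈4}))`) with `εreg·η_k² ≤ |Q_k^{s*}V(∂p) − 1|` makes the
record's (2.16) background of cube `a` the UNIT configuration.** [cite: Balaban1988Convergent, (2.16) p.257 (typing convention)] -/
theorem ukBox_record_eq_one_of_farLarge (ν : Stage7Numerics) (g : ℕ → ℝ) (K k : ℕ)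
    (a : ↥(cubeIndices (F.P K) (cubeSide (F.P K).L ν.M₂ (RkOfRecord (F.P K).L ν.r (g k)) k))) {V : GaugeField (F.P K) k (SU N)} {p : Plaq (F.P K) 0}
    (hp : plaqBonds p ⊆ extBonds (Bj ν.M₁ (cubeEnl (F.P K) (cubeSide (F.P K).L ν.M₂ (RkOfRecord (F.P K).L ν.r (g k)) k) a 4) k))
    (hfar : ν.εreg * (F.P K).eta k ^ 2 ≤ dist1 (GaugeField.plaqHol (qsstarGIter0 k V) p)) :
    ukBox (bgOfRecord (avOfRecord F N K) {U | PlaqSmall (ν.εreg * (F.P K).eta k ^ 2) U}) ν.M₁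
        (cubeEnl (F.P K) (cubeSide (F.P K).L ν.M₂ (RkOfRecord (F.P K).L ν.r (g k)) k) a 4) k V = fun _ => 1 :=
  ukBox_bgOfRecord_eq_one_of_farLarge (avOfRecord F N K) ν.M₁ hp hfar

/-- … so the record's block-sup statistic of cube `a` (13b ∕ 22b's tested variable) is `0`. [cite: Balaban1988Convergent, (2.17) p.257 (typing convention)] -/
theorem recordStat_eq_zero_of_farLarge (ν : Stage7Numerics) (g : ℕ → ℝ) (K k : ℕ)
    (a : ↥(cubeIndices (F.P K) (cubeSide (F.P K).L ν.M₂ (RkOfRecord (F.P K).L ν.r (g k)) k))) {V : GaugeField (F.P K) k (SU N)} {p : Plaq (F.P K) 0}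
    (hp : plaqBonds p ⊆ extBonds (Bj ν.M₁ (cubeEnl (F.P K) (cubeSide (F.P K).L ν.M₂ (RkOfRecord (F.P K).L ν.r (g k)) k) a 4) k))
    (hfar : ν.εreg * (F.P K).eta k ^ 2 ≤ dist1 (GaugeField.plaqHol (qsstarGIter0 k V) p)) :
    (⨆ q : ↥(plaqInside (cubeEnl (F.P K) (cubeSide (F.P K).L ν.M₂ (RkOfRecord (F.P K).L ν.r (g k)) k) a 1)),
        dist1 (GaugeField.plaqHol (ukBox (bgOfRecord (avOfRecord F N K) {U | PlaqSmall (ν.εreg * (F.P K).eta k ^ 2) U}) ν.M₁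
          (cubeEnl (F.P K) (cubeSide (F.P K).L ν.M₂ (RkOfRecord (F.P K).L ν.r (g k)) k) a 4) k V) q.1)) = 0 :=
  iSup_dist1_ukBox_eq_zero_of_farLarge (avOfRecord F N K) ν.M₁ hp hfar _

/-- ★ **THE RECORD's χ-SLOT OF CUBE `a` READS SMALL (`= 1`) UNDER ONE FAR LARGE PLAQUETTE**, at every positive threshold — in particular at the record's
`ε_kη_k²` and at every lowered threshold of the mixture ∕ histories roads. [cite: Balaban1988Convergent, (2.17) p.257 (typing convention)] -/
theorem chiSlot_record_eq_one_of_farLarge (ν : Stage7Numerics) (g : ℕ → ℝ) (K k : ℕ)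
    (a : ↥(cubeIndices (F.P K) (cubeSide (F.P K).L ν.M₂ (RkOfRecord (F.P K).L ν.r (g k)) k))) {V : GaugeField (F.P K) k (SU N)} {p : Plaq (F.P K) 0}
    (hp : plaqBonds p ⊆ extBonds (Bj ν.M₁ (cubeEnl (F.P K) (cubeSide (F.P K).L ν.M₂ (RkOfRecord (F.P K).L ν.r (g k)) k) a 4) k))
    (hfar : ν.εreg * (F.P K).eta k ^ 2 ≤ dist1 (GaugeField.plaqHol (qsstarGIter0 k V) p)) {θ : ℝ} (hθ : 0 < θ) :
    chiSmall (plaqInside (cubeEnl (F.P K) (cubeSide (F.P K).L ν.M₂ (RkOfRecord (F.P K).L ν.r (g k)) k) a 1)) θ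
      (ukBox (bgOfRecord (avOfRecord F N K) {U | PlaqSmall (ν.εreg * (F.P K).eta k ^ 2) U}) ν.M₁
        (cubeEnl (F.P K) (cubeSide (F.P K).L ν.M₂ (RkOfRecord (F.P K).L ν.r (g k)) k) a 4) k V) = 1 :=
  chiSmall_ukBox_eq_one_of_farLarge (avOfRecord F N K) ν.M₁ hp hfar _ hθ

/-- ★★ **22b's `hlocP` AT RAW LETTERS IS REFUTABLE**: the plaquette-level locality binder of `fibreIndep_recordStat_of_localPlaq` (verbatim) FAILS for every
fibre `s` through which some update makes a far `Γ₀`-plaquette of the datum `εreg·η_k²`-large, given one configuration at which a tested plaquette variable of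
cube `a` is not `1` (HYPOTHESES (i)–(ii); nothing about solvability asserted). [cite: Balaban1988Convergent, (2.16)–(2.17) p.257 (typing convention)] -/
theorem not_hlocP_record_of_witness (ν : Stage7Numerics) (g : ℕ → ℝ) (K k : ℕ) [DecidableEq (PBond (F.P K) k)] (s : Finset (PBond (F.P K) k))
    (a : ↥(cubeIndices (F.P K) (cubeSide (F.P K).L ν.M₂ (RkOfRecord (F.P K).L ν.r (g k)) k))) {p : Plaq (F.P K) 0}
    (hp : plaqBonds p ⊆ extBonds (Bj ν.M₁ (cubeEnl (F.P K) (cubeSide (F.P K).L ν.M₂ (RkOfRecord (F.P K).L ν.r (g k)) k) a 4) k))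
    {V₁ : GaugeField (F.P K) k (SU N)} {q : Plaq (F.P K) 0}
    (hq : q ∈ plaqInside (cubeEnl (F.P K) (cubeSide (F.P K).L ν.M₂ (RkOfRecord (F.P K).L ν.r (g k)) k) a 1))
    (hV₁ : GaugeField.plaqHol (ukBox (bgOfRecord (avOfRecord F N K) {U | PlaqSmall (ν.εreg * (F.P K).eta k ^ 2) U}) ν.M₁
      (cubeEnl (F.P K) (cubeSide (F.P K).L ν.M₂ (RkOfRecord (F.P K).L ν.r (g k)) k) a 4) k V₁) q ≠ 1)
    {y : s → SU N} (hy : ν.εreg * (F.P K).eta k ^ 2 ≤ dist1 (GaugeField.plaqHol (qsstarGIter0 k (Function.updateFinset V₁ s y)) p)) :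
    ¬ ∀ (V : GaugeField (F.P K) k (SU N)) (y : s → SU N) (q : ↥(plaqInside (cubeEnl (F.P K) (cubeSide (F.P K).L ν.M₂ (RkOfRecord (F.P K).L ν.r (g k)) k) a 1))),
      GaugeField.plaqHol (ukBox (bgOfRecord (avOfRecord F N K) {U | PlaqSmall (ν.εreg * (F.P K).eta k ^ 2) U}) ν.M₁ (cubeEnl (F.P K) (cubeSide (F.P K).L ν.M₂ (RkOfRecord (F.P K).L ν.r (g k)) k) a 4) k (Function.updateFinset V s y)) q.1
        = GaugeField.plaqHol (ukBox (bgOfRecord (avOfRecord F N K) {U | PlaqSmall (ν.εreg * (F.P K).eta k ^ 2) U}) ν.M₁ (cubeEnl (F.P K) (cubeSide (F.P K).L ν.M₂ (RkOfRecord (F.P K).L ν.r (g k)) k) a 4) k V) q.1 :=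
  not_localPlaq_bgOfRecord_of_witness (avOfRecord F N K) ν.M₁ s _ hp hq hV₁ hy

end AtRecord

end Summit.QuantumFields.YangMills.Theorems.N21ThresholdMixtureRStepLocalityRaw

end
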